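import Summits.Ventures.LatticeQCDFlow.TrivializingMaps.FisherObstruction
import Literature.Analysis.DeBrangesSpaces.HalfPlaneCauchy

/-!
HONEST FRAMING: exact (Metropolis-corrected) sampling algorithms for lattice gauge theory; figures
of merit are autocorrelation/cost numbers at stated couplings and volumes; no continuum-physics
claim.

# FisherStaircaseChain — THEOREM S, analytic and geometric core (THEORY-1.md §31): the exact
radius of a re-expanded logarithmic derivative, and the stage count of a chain of discs passing
an obstacle

Proposed tree path: `Summits/Ventures/LatticeQCDFlow/TrivializingMaps/FisherStaircaseChain.lean`
(OURS — venture-side, never `Literature/`). Mathematics-only companion (imports the tree file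
`FisherObstruction` and one landed Literature identity) of `FisherStaircase` (THEOREM S docked to
the lattice partition function) and of `FisherRadiusExact` (THEOREM F″). Cell `lqcd-flow`
(pub-lqcd), unit `pub-lqcd-theory1-g19`, 2026-08-22.

Setting. THEOREM F″ (`FisherRadiusExact`): Lüscher's flow-constant series is the Taylor series at
`s = 0` of `Z′/Z` (`Z(s) = ∫ D[U] e^{-sS}` entire) and converges EXACTLY up to the nearest zero of
`Z`. A STAIRCASE re-expands `Z′/Z` at successive centres `x₀, x₁, …, x_K`, using stage `k` on the
step to `x_{k+1}` with a margin `η ∈ (0,1)`: `|x_{k+1} - x_k| ≤ (1-η) ·` (a distance at which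
stage `k` still converges). This file proves the two ingredients of the stage count.

Results (all `[ours]` unless tagged; Mathlib + `Fisher.ne_zero_of_deriv_eq_mul`; the identity
`|x - w|² = (x - Re w)² + Im w²` is reused from the landed module
`Literature.Analysis.DeBrangesSpaces.HalfPlaneCauchy`):
* §1 (shifted F″ for ANY entire `Z`): `logDeriv_taylor_hasSum_of_zeroFree` — on a zero-free disc
  `B(c, R)` the Taylor series of `Z′/Z` at `c` sums to `Z′/Z`; `not_summable_beyond_zero_of_hasSum_
  logDeriv` — if `Z` is zero-free near `c` and SOME power series at `c` sums to `Z′/Z` near `c`,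
  then for every zero `s₀` of `Z` that series is not summable at any `|s - c| > |s₀ - c|` (bounded
  terms ⇒ holomorphic sum `g` on a disc containing `s₀`; `Z′ = gZ` there by the identity theorem;
  `Fisher.ne_zero_of_deriv_eq_mul` forbids the zero); `logDeriv_taylor_not_summable_of_zero`,
  `norm_sub_le_of_logDeriv_taylor_summable`. So the radius of the stage centred at `c` is EXACTLY
  `dist(c, {Z = 0})`, and a stage at `x_k` admissible with margin `η` has
  `|x_{k+1} - x_k| ≤ (1-η)|x_k - s₀|` for EVERY zero `s₀`.
* §2 (chain of discs w.r.t. an obstacle `z ∈ ℂ`; centres `x_k ∈ ℂ` with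
  `|x_{k+1} - x_k| ≤ (1-η)|x_k - z|`): `Staircase.pow_mul_dist_le` (`η^K|x₀ - z| ≤ |x_K - z|`),
  `Staircase.dist_le_pow_mul` (`|x_K - z| ≤ (2-η)^K|x₀ - z|`), the quasi-hyperbolic Riemann sum
  `Staircase.sum_step_div_dist_le` (`∑_{k<K} |x_{k+1} - x_k|/|x_k - z| ≤ (1-η)K`; cf. the
  quasihyperbolic length `∫ |dx|/dist(x, ∂Ω)` of Gehring–Palka); and for REAL centres crossing the
  abscissa of the obstacle (`x_j < Re z ≤ x_{j+1}`): `Staircase.dist_le_at_crossing`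
  (`|x_j - z| ≤ |Im z|/√(η(2-η))`), `Staircase.exists_crossing_bounds`, and the STAGE COUNT
  **`Staircase.count_ge`**:
  `K ≥ log(|x₀ - z|√(η(2-η))/|Im z|)/log(1/η) + log(|x_K - z|√(η(2-η))/|Im z|)/log(2-η)`
  — logarithmic in the ratio (distance of the endpoints to the obstacle) / (distance of the
  obstacle to the real axis). The greedy chain shows the count is attained up to `O(1)` (paper).

References: M. Lüscher, Commun. Math. Phys. 293 (2010) 899–919, §4 [bib `Luscher2010Trivializing`];
F. W. Gehring, B. P. Palka, J. Anal. Math. 30 (1976) 172–199 (quasihyperbolic metric; cf.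
R. Klén, M. Vuorinen, X. Zhang, arXiv:1104.3745, Def. 5 and ref. [gp]); THEORY-1.md §24 (F″),
§31 (S).
-/

open Filter Topology Complex Set Metric

namespace Summit.Ventures.LatticeQCDFlow.TrivializingMaps

/-! ## §1 Shifted THEOREM F″ for an entire function -/

section LogDerivTaylor

/-- **Convergence on a zero-free disc.** If `Z` is holomorphic and zero-free on `B(c, R)`, the
Taylor series of `Z′/Z` at `c` sums to `Z′/Z` at every point of `B(c, R)`. [folklore] -/
theorem logDeriv_taylor_hasSum_of_zeroFree {Z : ℂ → ℂ} {c : ℂ} {R : ℝ}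
    (hZ : DifferentiableOn ℂ Z (ball c R)) (hR : ∀ w ∈ ball c R, Z w ≠ 0) {s : ℂ}
    (hs : s ∈ ball c R) :
    HasSum (fun k : ℕ => (k.factorial : ℂ)⁻¹ * iteratedDeriv k (fun w => deriv Z w / Z w) c *
      (s - c) ^ k) (deriv Z s / Z s) := by
  have hZ' : DifferentiableOn ℂ (deriv Z) (ball c R) :=
    (hZ.analyticOnNhd isOpen_ball).deriv.differentiableOn
  have hf : DifferentiableOn ℂ (fun w => deriv Z w / Z w) (ball c R) := hZ'.div hZ hR
  have hT := Complex.hasSum_taylorSeries_on_ball hf hs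
  have hfun : (fun k : ℕ => (k.factorial : ℂ)⁻¹ • (s - c) ^ k •
      iteratedDeriv k (fun w => deriv Z w / Z w) c) = fun k : ℕ => (k.factorial : ℂ)⁻¹ *
      iteratedDeriv k (fun w => deriv Z w / Z w) c * (s - c) ^ k := by
    funext k
    rw [smul_eq_mul, smul_eq_mul]
    ring
  rw [hfun] at hT
  exact hT

/-- **No power series for `Z′/Z` converges beyond a zero of `Z`.** If `Z` is entire and zero-free
on `B(c, ρ₀)`, and a power series `∑ a_k (w - c)^k` sums to `Z′/Z` on `B(c, ρ₀)`, then for every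
zero `s₀` of `Z` the series is NOT summable at any `s` with `|s - c| > |s₀ - c|` (bounded terms ⇒
holomorphic sum `g` on a disc containing `s₀`, `Z′ = gZ` there by the identity theorem, and
`Fisher.ne_zero_of_deriv_eq_mul` forbids the zero). [ours] -/
theorem not_summable_beyond_zero_of_hasSum_logDeriv {Z : ℂ → ℂ} (hZ : Differentiable ℂ Z)
    {c : ℂ} {a : ℕ → ℂ} {ρ₀ : ℝ} (hρ₀ : 0 < ρ₀) (hZρ : ∀ w ∈ ball c ρ₀, Z w ≠ 0)
    (ha : ∀ w ∈ ball c ρ₀, HasSum (fun k => a k * (w - c) ^ k) (deriv Z w / Z w))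
    {s₀ : ℂ} (hz : Z s₀ = 0) {s : ℂ} (hs : ‖s₀ - c‖ < ‖s - c‖) :
    ¬ Summable fun k => a k * (s - c) ^ k := by
  intro hsum
  obtain ⟨M, hM⟩ : ∃ M : ℝ, ∀ k, ‖a k * (s - c) ^ k‖ ≤ M := by
    obtain ⟨M, hM⟩ := hsum.tendsto_atTop_zero.norm.bddAbove_range
    exact ⟨M, fun k => hM ⟨k, rfl⟩⟩
  have hs0 : 0 < ‖s - c‖ := (norm_nonneg _).trans_lt hs
  obtain ⟨r', hs₀r', hr's⟩ := exists_between hs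
  have hr'0 : 0 < r' := (norm_nonneg _).trans_lt hs₀r'
  have hq0 : 0 ≤ r' / ‖s - c‖ := by positivity
  have hq1 : r' / ‖s - c‖ < 1 := (div_lt_one hs0).mpr hr's
  have hg : DifferentiableOn ℂ (fun w => ∑' k, a k * (w - c) ^ k) (ball c r') := by
    refine Complex.differentiableOn_tsum_of_summable_norm (u := fun k => M * (r' / ‖s - c‖) ^ k)
      ((summable_geometric_of_lt_one hq0 hq1).mul_left M)
      (fun k => (((differentiable_id.sub_const c).pow k).const_mul _).differentiableOn)
      isOpen_ball fun k w hw => ?_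
    have hw' : ‖w - c‖ ≤ r' := (mem_ball_iff_norm.mp hw).le
    calc ‖a k * (w - c) ^ k‖ = ‖a k‖ * ‖w - c‖ ^ k := by rw [norm_mul, norm_pow]
      _ ≤ ‖a k‖ * r' ^ k := by gcongr
      _ = ‖a k * (s - c) ^ k‖ * (r' / ‖s - c‖) ^ k := by
          rw [norm_mul, norm_pow, div_pow]
          field_simp
      _ ≤ M * (r' / ‖s - c‖) ^ k := by gcongr; exact hM k
  have hZ'd : Differentiable ℂ (deriv Z) :=
    differentiableOn_univ.mp (hZ.differentiableOn.analyticOnNhd isOpen_univ).deriv.differentiableOn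
  have hρ₁0 : 0 < min ρ₀ r' := lt_min hρ₀ hr'0
  have hsmall : ∀ w ∈ ball c (min ρ₀ r'), deriv Z w = (∑' k, a k * (w - c) ^ k) * Z w := by
    intro w hw
    have hw0 : w ∈ ball c ρ₀ := ball_subset_ball (min_le_left _ _) hw
    rw [(ha w hw0).tsum_eq, div_mul_cancel₀ _ (hZρ w hw0)]
  have hφ : AnalyticOnNhd ℂ (fun w => deriv Z w - (∑' k, a k * (w - c) ^ k) * Z w) (ball c r') :=
    (hZ'd.differentiableOn.sub (hg.mul hZ.differentiableOn)).analyticOnNhd isOpen_ball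
  have hev0 : (fun w => deriv Z w - (∑' k, a k * (w - c) ^ k) * Z w) =ᶠ[𝓝 c] 0 := by
    filter_upwards [Metric.ball_mem_nhds c hρ₁0] with w hw
    rw [Pi.zero_apply, hsmall w hw, sub_self]
  have hEq := hφ.eqOn_zero_of_preconnected_of_eventuallyEq_zero
    (convex_ball c r').isPreconnected (mem_ball_self hr'0) hev0
  have hflow : ∀ w ∈ ball c r', deriv Z w = (∑' k, a k * (w - c) ^ k) * Z w := fun w hw => by
    have hw' := hEq hw
    simp only [Pi.zero_apply] at hw'
    exact sub_eq_zero.mp hw'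
  exact Fisher.ne_zero_of_deriv_eq_mul isOpen_ball (convex_ball c r').isPreconnected
    hZ.differentiableOn hg.continuousOn hflow (mem_ball_self hr'0) (hZρ c (mem_ball_self hρ₀)) s₀
    (mem_ball_iff_norm.mpr hs₀r') hz

/-- **Shifted THEOREM F″(iii) — exact divergence beyond the nearest zero.** For an entire `Z`
with `Z(c) ≠ 0` and a zero `s₀`, the Taylor series of `Z′/Z` at `c` is not summable at any `s`
with `|s - c| > |s₀ - c|`. With `logDeriv_taylor_hasSum_of_zeroFree`: its radius of convergence is
EXACTLY the distance from `c` to the zero set of `Z`. [ours] -/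
theorem logDeriv_taylor_not_summable_of_zero {Z : ℂ → ℂ} (hZ : Differentiable ℂ Z) {c : ℂ}
    (hc : Z c ≠ 0) {s₀ : ℂ} (hz : Z s₀ = 0) {s : ℂ} (hs : ‖s₀ - c‖ < ‖s - c‖) :
    ¬ Summable fun k : ℕ => (k.factorial : ℂ)⁻¹ * iteratedDeriv k (fun w => deriv Z w / Z w) c *
      (s - c) ^ k := by
  obtain ⟨ρ₀, hρ₀, hZρ⟩ : ∃ ρ₀ > 0, ∀ w ∈ ball c ρ₀, Z w ≠ 0 := by
    have hev : ∀ᶠ w in 𝓝 c, Z w ≠ 0 := hZ.continuous.continuousAt.eventually_ne hc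
    obtain ⟨ρ₀, hρ₀, hball⟩ := Metric.eventually_nhds_iff.mp hev
    exact ⟨ρ₀, hρ₀, fun w hw => hball (mem_ball.mp hw)⟩
  exact not_summable_beyond_zero_of_hasSum_logDeriv hZ hρ₀ hZρ
    (fun w hw => logDeriv_taylor_hasSum_of_zeroFree hZ.differentiableOn hZρ hw) hz hs

/-- Contrapositive bookkeeping form: if the Taylor series of `Z′/Z` at `c` (`Z(c) ≠ 0`) is
summable at `s`, every zero `s₀` of `Z` has `|s - c| ≤ |s₀ - c|`. [ours] -/
theorem norm_sub_le_of_logDeriv_taylor_summable {Z : ℂ → ℂ} (hZ : Differentiable ℂ Z) {c : ℂ}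
    (hc : Z c ≠ 0) {s : ℂ} (hsum : Summable fun k : ℕ => (k.factorial : ℂ)⁻¹ *
      iteratedDeriv k (fun w => deriv Z w / Z w) c * (s - c) ^ k) {s₀ : ℂ} (hz : Z s₀ = 0) :
    ‖s - c‖ ≤ ‖s₀ - c‖ :=
  not_lt.mp fun h => logDeriv_taylor_not_summable_of_zero hZ hc hz h hsum

end LogDerivTaylor

/-! ## §2 Chain-of-discs geometry (the stage count) -/

namespace Staircase

/-- One admissible step cannot shrink the distance to the obstacle by more than the factor `η`.
[ours] -/
theorem dist_succ_ge {z : ℂ} {x : ℕ → ℂ} {η : ℝ} {k : ℕ}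
    (h : ‖x (k + 1) - x k‖ ≤ (1 - η) * ‖x k - z‖) : η * ‖x k - z‖ ≤ ‖x (k + 1) - z‖ := by
  have htri : ‖x k - z‖ ≤ ‖x (k + 1) - z‖ + ‖x (k + 1) - x k‖ := by
    calc ‖x k - z‖ = ‖(x (k + 1) - z) - (x (k + 1) - x k)‖ := by congr 1; ring
      _ ≤ ‖x (k + 1) - z‖ + ‖x (k + 1) - x k‖ := norm_sub_le _ _
  linarith

/-- One admissible step cannot grow the distance to the obstacle by more than the factor `2 - η`.
[ours] -/
theorem dist_succ_le {z : ℂ} {x : ℕ → ℂ} {η : ℝ} {k : ℕ}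
    (h : ‖x (k + 1) - x k‖ ≤ (1 - η) * ‖x k - z‖) : ‖x (k + 1) - z‖ ≤ (2 - η) * ‖x k - z‖ := by
  have htri : ‖x (k + 1) - z‖ ≤ ‖x (k + 1) - x k‖ + ‖x k - z‖ := by
    calc ‖x (k + 1) - z‖ = ‖(x (k + 1) - x k) + (x k - z)‖ := by congr 1; ring
      _ ≤ ‖x (k + 1) - x k‖ + ‖x k - z‖ := norm_add_le _ _
  linarith

/-- **`K` admissible steps approach the obstacle at most geometrically: `η^K |x₀ - z| ≤ |x_K - z|`**
— i.e. `K ≥ log(|x₀ - z| / |x_K - z|) / log(1/η)`. [ours] -/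
theorem pow_mul_dist_le {z : ℂ} {x : ℕ → ℂ} {η : ℝ} (hη : 0 ≤ η) {K : ℕ}
    (h : ∀ k < K, ‖x (k + 1) - x k‖ ≤ (1 - η) * ‖x k - z‖) :
    η ^ K * ‖x 0 - z‖ ≤ ‖x K - z‖ := by
  induction K with
  | zero => simp
  | succ K ih =>
    have h1 := ih fun k hk => h k (Nat.lt_succ_of_lt hk)
    calc η ^ (K + 1) * ‖x 0 - z‖ = η * (η ^ K * ‖x 0 - z‖) := by ring
      _ ≤ η * ‖x K - z‖ := mul_le_mul_of_nonneg_left h1 hη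
      _ ≤ ‖x (K + 1) - z‖ := dist_succ_ge (h K (Nat.lt_succ_self K))

/-- **`K` admissible steps recede from the obstacle at most geometrically:
`|x_K - z| ≤ (2-η)^K |x₀ - z|`.** [ours] -/
theorem dist_le_pow_mul {z : ℂ} {x : ℕ → ℂ} {η : ℝ} (hη : η ≤ 1) {K : ℕ}
    (h : ∀ k < K, ‖x (k + 1) - x k‖ ≤ (1 - η) * ‖x k - z‖) :
    ‖x K - z‖ ≤ (2 - η) ^ K * ‖x 0 - z‖ := by
  induction K with
  | zero => simp
  | succ K ih =>
    have h1 := ih fun k hk => h k (Nat.lt_succ_of_lt hk)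
    have h2η : 0 ≤ 2 - η := by linarith
    calc ‖x (K + 1) - z‖ ≤ (2 - η) * ‖x K - z‖ := dist_succ_le (h K (Nat.lt_succ_self K))
      _ ≤ (2 - η) * ((2 - η) ^ K * ‖x 0 - z‖) := mul_le_mul_of_nonneg_left h1 h2η
      _ = (2 - η) ^ (K + 1) * ‖x 0 - z‖ := by ring

/-- The quasi-hyperbolic Riemann sum of an admissible chain: `∑_{k<K} Δ_k / |x_k - z| ≤ (1-η) K`.
[ours] -/
theorem sum_step_div_dist_le {z : ℂ} {x : ℕ → ℂ} {η : ℝ} (hη : η ≤ 1) {K : ℕ}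
    (h : ∀ k < K, ‖x (k + 1) - x k‖ ≤ (1 - η) * ‖x k - z‖) :
    ∑ k ∈ Finset.range K, ‖x (k + 1) - x k‖ / ‖x k - z‖ ≤ (1 - η) * K := by
  have hterm : ∀ k ∈ Finset.range K, ‖x (k + 1) - x k‖ / ‖x k - z‖ ≤ 1 - η := by
    intro k hk
    rcases eq_or_lt_of_le (norm_nonneg (x k - z)) with h0 | hpos
    · rw [← h0, div_zero]; linarith
    · exact (div_le_iff₀ hpos).mpr (h k (Finset.mem_range.mp hk))
  calc ∑ k ∈ Finset.range K, ‖x (k + 1) - x k‖ / ‖x k - z‖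
      ≤ ∑ k ∈ Finset.range K, (1 - η) := Finset.sum_le_sum hterm
    _ = (1 - η) * K := by rw [Finset.sum_const, Finset.card_range, nsmul_eq_mul, mul_comm]

/-- A real chain with `x₀ < a ≤ x_K` crosses `a` at some step `j < K`. [folklore] -/
theorem exists_crossing {x : ℕ → ℝ} {a : ℝ} {K : ℕ} (h0 : x 0 < a) (hK : a ≤ x K) :
    ∃ j, j < K ∧ x j < a ∧ a ≤ x (j + 1) := by
  induction K with
  | zero => exact absurd hK (not_le.mpr h0)
  | succ K ih =>
    by_cases hK' : a ≤ x K
    · obtain ⟨j, hj, h1, h2⟩ := ih hK'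
      exact ⟨j, Nat.lt_succ_of_lt hj, h1, h2⟩
    · exact ⟨K, Nat.lt_succ_self K, not_le.mp hK', hK⟩

/-- **The crossing step.** If a real chain with margin `η ∈ (0,1]` crosses the abscissa of the
obstacle in step `k` (`x_k < Re z ≤ x_{k+1}`, `x_{k+1} - x_k ≤ (1-η)|x_k - z|`), then the centre
`x_k` is within `|Im z| / √(η(2-η))` of the obstacle (`u = Re z - x_k ≤ (1-η)√(u² + Im z²)`).
[ours] -/
theorem dist_le_at_crossing {z : ℂ} {x : ℕ → ℝ} {η : ℝ} (hη0 : 0 < η) (hη1 : η ≤ 1) {k : ℕ}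
    (h : x (k + 1) - x k ≤ (1 - η) * ‖(x k : ℂ) - z‖) (hlt : x k < z.re) (hle : z.re ≤ x (k + 1)) :
    ‖(x k : ℂ) - z‖ ≤ |z.im| / Real.sqrt (η * (2 - η)) := by
  have hρsq : ‖(x k : ℂ) - z‖ ^ 2 = (x k - z.re) ^ 2 + z.im ^ 2 :=
    Literature.Analysis.DeBrangesSpaces.norm_ofReal_sub_sq _ _
  have hρ0 : 0 ≤ ‖(x k : ℂ) - z‖ := norm_nonneg _
  have hu0 : 0 < z.re - x k := sub_pos.mpr hlt
  have hu : z.re - x k ≤ (1 - η) * ‖(x k : ℂ) - z‖ := by linarith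
  have husq : (z.re - x k) ^ 2 ≤ ((1 - η) * ‖(x k : ℂ) - z‖) ^ 2 := pow_le_pow_left₀ hu0.le hu 2
  have hprod : 0 < η * (2 - η) := by nlinarith
  have hkey : η * (2 - η) * ‖(x k : ℂ) - z‖ ^ 2 ≤ z.im ^ 2 := by nlinarith [hρsq, husq]
  have hpos : 0 < Real.sqrt (η * (2 - η)) := Real.sqrt_pos.mpr hprod
  rw [le_div_iff₀ hpos]
  have hsq : (‖(x k : ℂ) - z‖ * Real.sqrt (η * (2 - η))) ^ 2 ≤ |z.im| ^ 2 := by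
    rw [mul_pow, Real.sq_sqrt hprod.le, sq_abs]
    nlinarith [hkey]
  have h2 := sq_le_sq.mp hsq
  rwa [abs_abs, abs_of_nonneg (by positivity)] at h2

/-- **THEOREM S (geometric core) — the stage count of a real chain passing an obstacle.** A real
chain `x₀, …, x_K` with margin `η ∈ (0,1)` w.r.t. the obstacle `z` (`0 ≤ x_{k+1} - x_k ≤
(1-η)|x_k - z|`) and `x₀ < Re z ≤ x_K` has a crossing index `j < K` with
`η^j |x₀ - z| ≤ |x_j - z| ≤ |Im z|/√(η(2-η))` and `|x_K - z| ≤ (2-η)^{K-j} |Im z|/√(η(2-η))`.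
[ours] -/
theorem exists_crossing_bounds {z : ℂ} {x : ℕ → ℝ} {η : ℝ} (hη0 : 0 < η) (hη1 : η ≤ 1) {K : ℕ}
    (hmono : ∀ k < K, x k ≤ x (k + 1))
    (h : ∀ k < K, x (k + 1) - x k ≤ (1 - η) * ‖(x k : ℂ) - z‖)
    (h0 : x 0 < z.re) (hK : z.re ≤ x K) :
    ∃ j, j < K ∧ x j < z.re ∧ z.re ≤ x (j + 1) ∧
      η ^ j * ‖(x 0 : ℂ) - z‖ ≤ ‖(x j : ℂ) - z‖ ∧
      ‖(x j : ℂ) - z‖ ≤ |z.im| / Real.sqrt (η * (2 - η)) ∧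
      ‖(x K : ℂ) - z‖ ≤ (2 - η) ^ (K - j) * (|z.im| / Real.sqrt (η * (2 - η))) := by
  obtain ⟨j, hjK, hj1, hj2⟩ := exists_crossing h0 hK
  have hc : ∀ k < K, ‖((x (k + 1) : ℝ) : ℂ) - (x k : ℂ)‖ ≤ (1 - η) * ‖(x k : ℂ) - z‖ := by
    intro k hk
    rw [← ofReal_sub, norm_real, Real.norm_eq_abs, abs_of_nonneg (sub_nonneg.mpr (hmono k hk))]
    exact h k hk
  have hbefore : η ^ j * ‖(x 0 : ℂ) - z‖ ≤ ‖(x j : ℂ) - z‖ :=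
    pow_mul_dist_le (x := fun k => (x k : ℂ)) hη0.le fun k hk => hc k (hk.trans hjK)
  have hcross : ‖(x j : ℂ) - z‖ ≤ |z.im| / Real.sqrt (η * (2 - η)) :=
    dist_le_at_crossing hη0 hη1 (h j hjK) hj1 hj2
  have hafter : ‖(x (j + (K - j)) : ℂ) - z‖ ≤ (2 - η) ^ (K - j) * ‖(x (j + 0) : ℂ) - z‖ :=
    dist_le_pow_mul (x := fun k => (x (j + k) : ℂ)) (z := z) hη1 (K := K - j) fun k hk => by
      simpa only [Nat.add_succ] using hc (j + k) (by omega)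
  rw [Nat.add_sub_cancel' hjK.le, Nat.add_zero] at hafter
  have h2η : 0 ≤ (2 - η) ^ (K - j) := pow_nonneg (by linarith) _
  exact ⟨j, hjK, hj1, hj2, hbefore, hcross, hafter.trans (mul_le_mul_of_nonneg_left hcross h2η)⟩

/-- **THEOREM S (geometric core, log form) — `K ≥ log(|x₀ - z|√(η(2-η))/|Im z|)/log(1/η) +
log(|x_K - z|√(η(2-η))/|Im z|)/log(2-η)`** for every real `η`-margined chain from `x₀ < Re z` to
`x_K ≥ Re z` (`0 < η < 1`; `Im z ≠ 0` is forced). [ours] -/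
theorem count_ge {z : ℂ} {x : ℕ → ℝ} {η : ℝ} (hη0 : 0 < η) (hη1 : η < 1) {K : ℕ}
    (hmono : ∀ k < K, x k ≤ x (k + 1))
    (h : ∀ k < K, x (k + 1) - x k ≤ (1 - η) * ‖(x k : ℂ) - z‖)
    (h0 : x 0 < z.re) (hK : z.re ≤ x K) :
    Real.log (‖(x 0 : ℂ) - z‖ * Real.sqrt (η * (2 - η)) / |z.im|) / Real.log (1 / η) +
      Real.log (‖(x K : ℂ) - z‖ * Real.sqrt (η * (2 - η)) / |z.im|) / Real.log (2 - η) ≤ K := by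
  obtain ⟨j, hjK, hj1, -, hbefore, hcross, hafter⟩ :=
    exists_crossing_bounds hη0 hη1.le hmono h h0 hK
  have hprod : 0 < η * (2 - η) := by nlinarith
  have hsq : 0 < Real.sqrt (η * (2 - η)) := Real.sqrt_pos.mpr hprod
  -- `Im z ≠ 0`: otherwise the crossing centre would coincide with `z`.
  have hρj : 0 < ‖(x j : ℂ) - z‖ := by
    refine norm_pos_iff.mpr (sub_ne_zero.mpr fun hxz => ?_)
    have : (x j : ℂ).re = z.re := by rw [hxz]
    rw [ofReal_re] at this
    exact hj1.ne this
  have hb : 0 < |z.im| := by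
    have h1 : 0 < |z.im| / Real.sqrt (η * (2 - η)) := hρj.trans_le hcross
    by_contra hb
    have hb0 : |z.im| = 0 := le_antisymm (not_lt.mp hb) (abs_nonneg _)
    rw [hb0, zero_div] at h1
    exact lt_irrefl _ h1
  set C : ℝ := |z.im| / Real.sqrt (η * (2 - η)) with hCdef
  have hC : 0 < C := div_pos hb hsq
  have hρ0 : 0 < ‖(x 0 : ℂ) - z‖ := by
    refine norm_pos_iff.mpr (sub_ne_zero.mpr fun hxz => ?_)
    have : (x 0 : ℂ).re = z.re := by rw [hxz]
    rw [ofReal_re] at this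
    exact h0.ne this
  have hρK : 0 < ‖(x K : ℂ) - z‖ := by
    refine norm_pos_iff.mpr (sub_ne_zero.mpr fun hxz => ?_)
    have : (x K : ℂ).im = z.im := by rw [hxz]
    rw [ofReal_im] at this
    exact hb.ne' (by rw [← this, abs_zero])
  have hlog1 : 0 < Real.log (1 / η) := Real.log_pos (by rw [lt_div_iff₀ hη0]; linarith)
  have hlog2 : 0 < Real.log (2 - η) := Real.log_pos (by linarith)
  -- the two counts
  have hA : Real.log (‖(x 0 : ℂ) - z‖ * Real.sqrt (η * (2 - η)) / |z.im|) ≤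
      j * Real.log (1 / η) := by
    have h1 : η ^ j * ‖(x 0 : ℂ) - z‖ ≤ C := hbefore.trans hcross
    have h2 := Real.log_le_log (by positivity) h1
    rw [Real.log_mul (by positivity) hρ0.ne', Real.log_pow] at h2
    have h3 : Real.log (‖(x 0 : ℂ) - z‖ * Real.sqrt (η * (2 - η)) / |z.im|) =
        Real.log ‖(x 0 : ℂ) - z‖ - Real.log C := by
      rw [hCdef, Real.log_div (by positivity) hb.ne', Real.log_div hb.ne' hsq.ne',
        Real.log_mul hρ0.ne' hsq.ne']
      ring
    rw [h3, one_div, Real.log_inv]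
    linarith
  have hB : Real.log (‖(x K : ℂ) - z‖ * Real.sqrt (η * (2 - η)) / |z.im|) ≤
      ((K - j : ℕ) : ℝ) * Real.log (2 - η) := by
    have h2 := Real.log_le_log hρK hafter
    rw [Real.log_mul (pow_pos (by linarith) _).ne' hC.ne', Real.log_pow] at h2
    have h3 : Real.log (‖(x K : ℂ) - z‖ * Real.sqrt (η * (2 - η)) / |z.im|) =
        Real.log ‖(x K : ℂ) - z‖ - Real.log C := by
      rw [hCdef, Real.log_div (by positivity) hb.ne', Real.log_div hb.ne' hsq.ne',
        Real.log_mul hρK.ne' hsq.ne']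
      ring
    rw [h3]
    linarith
  have hKj : ((K - j : ℕ) : ℝ) = (K : ℝ) - j := by
    rw [Nat.cast_sub hjK.le]
  rw [hKj] at hB
  have hA' := (div_le_iff₀ hlog1).mpr hA
  have hB' := (div_le_iff₀ hlog2).mpr hB
  linarith

end Staircase

end Summit.Ventures.LatticeQCDFlow.TrivializingMaps
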